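import Summits.KontsevichZagierPeriods.KontsevichZagierPeriods.Theorems.PentagonInKZ.Negative.KernelImplies

/-!
# `PentagonInKZ` (stmt-KontsevichZagierPeriods-11348) — negative knowledge, part 5: the dispensable hypotheses

Two hypotheses of the crux `FurushoPentagon.PentagonInKZ` are NOT load-bearing.
* §11 **H3 (non-degeneracy `∃ u, χ u = 1`)**: `pentagonInKZ_iff_withoutUnit` — the crux is
  equivalent to its H3-free version (statement inlined).  For `χ` with H1, H2 only, `e := χ[pt,1]` is an idempotent with
  `χ = e·χ`; the pentagon holds over `R/(1-e)` by the crux (there `χ` becomes a realisation), over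
  `R/(e)` trivially (the series is `0`), over the product from the two factors
  (`drinfeldPentagon_of_fst_snd`, via the base-change models of `AssociatorsBaseChange.lean`), and
  over `R` by descent along the injection `R ↪ R/(1-e) × R/(e)`
  (`NCSeries.DrinfeldPentagon.of_map_injective`).
* §12 **`[Algebra ℚ R]`**: H1–H3 force every positive integer to be a unit in `R`
  (`isUnit_natCast_of_isRealisation`: `[pt,1] ≡ n·[pt,1/n]` by integrand additivity), so the
  `ℚ`-algebra structure is forced (and unique).
[cite: KontsevichZagier2001, §1.2; Furusho2011, §2]
-/

noncomputable section

open Literature.NumberTheory.Transcendental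

namespace Summit.KontsevichZagierPeriods.FurushoPentagon.PentagonInKZNegative

open Summit.KontsevichZagierPeriods.KontsevichZagierPeriods.Theses.FurushoPentagon (PentagonInKZ)

open Literature.Barriers.KontsevichZagierPeriods.KZ (constRep constRep_value)

/-! ## §11 H3 (non-degeneracy) is NOT load-bearing: the crux implies its own H3-free version -/

section Functoriality

variable {R : Type} [CommRing R] [Algebra ℚ R] {S : Type} [CommRing S] [Algebra ℚ S]

/-- **Naturality of the crux series in the realisation**: post-composing `χ` with a ring map `g`
changes coefficients along `g`. [folklore] -/
theorem cruxSeries_comp (g : R →+* S) (χ : KZ.FormalRep →+ R) (Z : List ℕ → KZ.FormalRep) :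
    cruxSeries S (g.toAddMonoidHom.comp χ) Z = NCSeries.map g (cruxSeries R χ Z) := by
  funext W
  rw [NCSeries.map_apply, ← chi_cruxLift, ← chi_cruxLift]
  rfl

omit [Algebra ℚ R] in
/-- The zero series satisfies the pentagon (`0 = 0`). [folklore] -/
theorem drinfeldPentagon_zero : NCSeries.DrinfeldPentagon (0 : NCSeries Bool R) := by
  intro N
  simp [NCSeries.subst₂, NCSeries.evalTrunc]

omit [Algebra ℚ R] [Algebra ℚ S] in
/-- Composition of coefficient changes. [folklore] -/
theorem map_map_ncseries {T : Type} [CommRing T] (f : R →+* S) (g : S →+* T)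
    (φ : NCSeries Bool R) : NCSeries.map g (NCSeries.map f φ) = NCSeries.map (g.comp f) φ := by
  funext W; rfl

end Functoriality

section Product

variable {R₁ : Type} [CommRing R₁] [Algebra ℚ R₁] {R₂ : Type} [CommRing R₂] [Algebra ℚ R₂]

open scoped TensorProduct in
/-- In the base-change model over a product ring, an element killed by both projections is `0`
(`inl ∘ fst + inr ∘ snd = id`, tensored with the identity). [folklore] -/
theorem model_eq_zero_of_fst_snd {ι : Type} {N : ℕ}
    (u : (R₁ × R₂) ⊗[ℚ] DrinfeldKohnoTrunc ℚ ι N)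
    (h₁ : Algebra.TensorProduct.map (RingHom.fst R₁ R₂).toRatAlgHom
      (AlgHom.id ℚ (DrinfeldKohnoTrunc ℚ ι N)) u = 0)
    (h₂ : Algebra.TensorProduct.map (RingHom.snd R₁ R₂).toRatAlgHom
      (AlgHom.id ℚ (DrinfeldKohnoTrunc ℚ ι N)) u = 0) : u = 0 := by
  have key : ∀ w : (R₁ × R₂) ⊗[ℚ] DrinfeldKohnoTrunc ℚ ι N,
      TensorProduct.map (LinearMap.inl ℚ R₁ R₂) LinearMap.id
          (Algebra.TensorProduct.map (RingHom.fst R₁ R₂).toRatAlgHom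
            (AlgHom.id ℚ (DrinfeldKohnoTrunc ℚ ι N)) w) +
        TensorProduct.map (LinearMap.inr ℚ R₁ R₂) LinearMap.id
          (Algebra.TensorProduct.map (RingHom.snd R₁ R₂).toRatAlgHom
            (AlgHom.id ℚ (DrinfeldKohnoTrunc ℚ ι N)) w) = w := by
    intro w
    induction w using TensorProduct.induction_on with
    | zero => simp
    | tmul r d =>
      obtain ⟨a, b⟩ := r
      simp only [Algebra.TensorProduct.map_tmul, AlgHom.id_apply, TensorProduct.map_tmul,
        LinearMap.id_apply, LinearMap.inl_apply, LinearMap.inr_apply, ← TensorProduct.add_tmul,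
        Prod.mk_add_mk, add_zero, zero_add]
      rfl
    | add x y hx hy =>
      simp only [map_add]
      rw [add_add_add_comm, hx, hy]
  rw [← key u, h₁, h₂, map_zero, map_zero, add_zero]

/-- **An element of `U𝔞 ⊗ (R₁ × R₂)` is determined by its two projections.** [folklore] -/
theorem dkt_eq_of_fst_snd {ι : Type} {N : ℕ} {x y : DrinfeldKohnoTrunc (R₁ × R₂) ι N}
    (h₁ : DrinfeldKohnoTrunc.map (RingHom.fst R₁ R₂) x = DrinfeldKohnoTrunc.map (RingHom.fst R₁ R₂) y)
    (h₂ : DrinfeldKohnoTrunc.map (RingHom.snd R₁ R₂) x = DrinfeldKohnoTrunc.map (RingHom.snd R₁ R₂) y) :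
    x = y := by
  rw [← sub_eq_zero]
  apply DrinfeldKohnoTrunc.toModel_injective (R₁ × R₂) ι N
  rw [map_zero]
  refine model_eq_zero_of_fst_snd _ ?_ ?_
  · rw [← DrinfeldKohnoTrunc.toModel_map, map_sub, h₁, sub_self, map_zero]
  · rw [← DrinfeldKohnoTrunc.toModel_map, map_sub, h₂, sub_self, map_zero]

/-- **The pentagon over a product ring follows from the pentagon of the two projections.**
[folklore] -/
theorem drinfeldPentagon_of_fst_snd {ψ : NCSeries Bool (R₁ × R₂)}
    (h₁ : NCSeries.DrinfeldPentagon (NCSeries.map (RingHom.fst R₁ R₂) ψ))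
    (h₂ : NCSeries.DrinfeldPentagon (NCSeries.map (RingHom.snd R₁ R₂) ψ)) :
    NCSeries.DrinfeldPentagon ψ := by
  intro N
  refine dkt_eq_of_fst_snd ?_ ?_
  · simpa only [map_mul, map_add, NCSeries.map_subst₂, NCSeries.t₄, DrinfeldKohnoTrunc.map_t]
      using h₁ N
  · simpa only [map_mul, map_add, NCSeries.map_subst₂, NCSeries.t₄, DrinfeldKohnoTrunc.map_t]
      using h₂ N

end Product

/-- **H3 is NOT load-bearing: the crux implies its own H3-free version.**  For `χ` with H1, H2
only, `e := χ[pt,1]` is an idempotent with `χ = e·χ`; over `R₁ = R/(1-e)` the composite `χ₁` is a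
genuine realisation (pentagon by the crux), over `R₂ = R/(e)` the series is `0` (pentagon
trivially), `R → R₁ × R₂` is injective, the pentagon over the product comes from the two factors
(`drinfeldPentagon_of_fst_snd`, base-change models of `AssociatorsBaseChange.lean`) and descends
along the injection (`DrinfeldPentagon.of_map_injective`).  (Conversely `WithoutUnit → crux`
trivially.) [folklore] -/
theorem pentagonInKZWithoutUnit_of (h : PentagonInKZ) :
    (∀ (R : Type) [CommRing R] [Algebra ℚ R] (χ : KZ.FormalRep →+ R),
        (∀ c ∈ KZ.relations, χ c = 0) → (∀ a b, χ (a * b) = χ a * χ b) →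
        ∀ Z : List ℕ → KZ.FormalRep, AgreesWithSimplex Z → NCSeries.DrinfeldPentagon (cruxSeries R χ Z)) := by
  intro R _ _ χ h1 h2 Z hZ
  classical
  set e : R := χ (KZ.of KZ.IntegralRep.unit) with he
  have hχe : ∀ c, χ c = e * χ c := fun c => by
    have h0 := h1 _ (KZ.of_unit_mul_sub_mem_relations c)
    rw [map_sub, h2, sub_eq_zero] at h0
    exact h0.symm
  have hee : e * e = e := (hχe _).symm
  -- the two quotients
  let I₁ : Ideal R := Ideal.span {1 - e}
  let I₂ : Ideal R := Ideal.span {e}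
  let π₁ : R →+* R ⧸ I₁ := Ideal.Quotient.mk I₁
  let π₂ : R →+* R ⧸ I₂ := Ideal.Quotient.mk I₂
  -- over R₁ the composite is a realisation
  have hp₁ : NCSeries.DrinfeldPentagon (NCSeries.map π₁ (cruxSeries R χ Z)) := by
    rw [← cruxSeries_comp]
    refine (pentagonInKZ_iff.mp h) (R ⧸ I₁) (π₁.toAddMonoidHom.comp χ) (fun c hc => ?_)
      (fun a b => ?_) ⟨KZ.of KZ.IntegralRep.unit, ?_⟩ Z hZ
    · simp [h1 c hc]
    · simp [h2]
    · change π₁ (χ (KZ.of KZ.IntegralRep.unit)) = 1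
      rw [← he, ← map_one π₁]
      exact (Ideal.Quotient.eq).mpr (Ideal.mem_span_singleton'.mpr ⟨-1, by ring⟩)
  -- over R₂ the series vanishes
  have hp₂ : NCSeries.DrinfeldPentagon (NCSeries.map π₂ (cruxSeries R χ Z)) := by
    have h0 : NCSeries.map π₂ (cruxSeries R χ Z) = 0 := by
      funext W
      rw [NCSeries.map_apply, ← chi_cruxLift, hχe]
      exact Ideal.Quotient.eq_zero_iff_mem.mpr (Ideal.mem_span_singleton'.mpr ⟨_, mul_comm _ _⟩)
    rw [h0]; exact drinfeldPentagon_zero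
  -- R → R₁ × R₂ is injective
  let f : R →+* (R ⧸ I₁) × (R ⧸ I₂) := RingHom.prod π₁ π₂
  have hf : Function.Injective f := by
    intro a b hab
    rw [← sub_eq_zero]
    set r := a - b
    have hr : f r = 0 := by simp [r, map_sub, hab]
    have hr₁ : r ∈ I₁ := Ideal.Quotient.eq_zero_iff_mem.mp (congrArg Prod.fst hr)
    have hr₂ : r ∈ I₂ := Ideal.Quotient.eq_zero_iff_mem.mp (congrArg Prod.snd hr)
    obtain ⟨u, hu⟩ := Ideal.mem_span_singleton'.mp hr₁
    obtain ⟨v, hv⟩ := Ideal.mem_span_singleton'.mp hr₂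
    have hre : r * e = 0 := by rw [← hu]; linear_combination (-u) * hee
    have hre' : r * (1 - e) = 0 := by rw [← hv]; linear_combination (-v) * hee
    calc r = r * e + r * (1 - e) := by ring
      _ = 0 := by rw [hre, hre', add_zero]
  -- pentagon over the product, then descend
  refine NCSeries.DrinfeldPentagon.of_map_injective f hf (drinfeldPentagon_of_fst_snd ?_ ?_)
  · rw [map_map_ncseries]; exact hp₁
  · rw [map_map_ncseries]; exact hp₂

/-- Hence the crux and its H3-free version are EQUIVALENT. [folklore] -/
theorem pentagonInKZ_iff_withoutUnit :
    PentagonInKZ ↔ (∀ (R : Type) [CommRing R] [Algebra ℚ R] (χ : KZ.FormalRep →+ R),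
        (∀ c ∈ KZ.relations, χ c = 0) → (∀ a b, χ (a * b) = χ a * χ b) →
        ∀ Z : List ℕ → KZ.FormalRep, AgreesWithSimplex Z → NCSeries.DrinfeldPentagon (cruxSeries R χ Z)) :=
  ⟨pentagonInKZWithoutUnit_of, fun h => pentagonInKZ_iff.mpr fun R _ _ χ h1 h2 _ Z hZ =>
    h R χ h1 h2 Z hZ⟩

/-! ## §12 `[Algebra ℚ R]` is redundant: the rules force `R` to be a `ℚ`-algebra -/

/-- **Additivity of constants is a move**: `[pt, a+b] − [pt, a] − [pt, b] ∈ relations`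
(integrand additivity). [cite: KontsevichZagier2001, §1.2 rule (1)] -/
theorem constRep_add_mem_relations (a b : ℚ) :
    KZ.of (constRep (a + b)) - KZ.of (constRep a) - KZ.of (constRep b) ∈ KZ.relations := by
  refine KZ.integrandAddRel_subset_relations ⟨0, constRep (a + b), constRep a, constRep b,
    ?_, ?_, fun x _ => ?_, rfl⟩
  · rw [constRep_domain, constRep_domain]
  · rw [constRep_domain, constRep_domain]
  · rw [Pi.add_apply, constRep_integrand, constRep_integrand, constRep_integrand, Rat.cast_add]

/-- `[pt, n·a] − n·[pt, a] ∈ relations`. [cite: KontsevichZagier2001, §1.2 rule (1)] -/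
theorem constRep_nsmul_mem_relations (a : ℚ) :
    ∀ n : ℕ, KZ.of (constRep (n * a)) - n • KZ.of (constRep a) ∈ KZ.relations
  | 0 => by
    have h := constRep_add_mem_relations 0 0
    rw [add_zero, sub_self, zero_sub] at h
    simpa using h
  | n + 1 => by
    have h := KZ.relations.add_mem (constRep_add_mem_relations (n * a) a)
      (constRep_nsmul_mem_relations a n)
    have e1 : ((n + 1 : ℕ) : ℚ) * a = n * a + a := by push_cast; ring
    rw [e1, add_smul, one_smul]
    convert h using 1
    abel

/-- `[pt, 1]` is the unit representation. [folklore] -/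
theorem constRep_one : constRep 1 = KZ.IntegralRep.unit :=
  KZ.IntegralRep.ext' (constRep_domain 1) (funext fun x => by
    rw [constRep_integrand, Rat.cast_one]; rfl)

/-- **The rules force every positive integer to be invertible in the target of a realisation**
(`1 = χ[pt,1] = n · χ[pt,1/n]`): the hypothesis `[Algebra ℚ R]` of the crux is redundant given
H1–H3 (a commutative ring admits at most one `ℚ`-algebra structure). [folklore] -/
theorem isUnit_natCast_of_isRealisation {R : Type} [CommRing R] {χ : KZ.FormalRep →+ R}
    (hχ : IsRealisation R χ) {n : ℕ} (hn : n ≠ 0) : IsUnit ((n : R)) := by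
  have h := hχ.rel _ (constRep_nsmul_mem_relations (1 / n) n)
  rw [mul_one_div_cancel (by exact_mod_cast hn), constRep_one, map_sub, map_nsmul, chi_unit hχ,
    sub_eq_zero, nsmul_eq_mul] at h
  exact isUnit_iff_exists_inv.mpr ⟨_, h.symm⟩



end Summit.KontsevichZagierPeriods.FurushoPentagon.PentagonInKZNegative
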